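import Literature.AlgebraicGeometry.Motives.RatFnAffine
import Literature.AlgebraicGeometry.Motives.CartierDivisorExtension
import HarnessLib

/-!
# Coherent families of rational functions on an integral scheme (fractional-ideal sheaves, chartwise)

Let `Z` be an integral scheme with function field `K = K(Z)` and let `A` be a commutative ring
acting on `K` (`[Algebra A K]`, e.g. the base ring `Γ(S, 𝒪_S)` of `Z → S`). A **coherent
`𝒪_Z`-submodule of the constant sheaf `K`** ("fractional ideal sheaf"; a torsion-free coherent
module of rank `≤ 1` together with its embedding into `𝒦_Z`; Görtz–Wedhorn I, (7.9), (11.9),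
Def. 11.24: `𝒪_Z(D) ⊆ 𝒦_Z`; The Stacks Project, Tag 01AI/01BU) is determined by its sections on
a finite affine open cover all of whose finite intersections `U_t` are affine and non-empty, the
restriction maps being INCLUSIONS inside `K` — the shape of family the tree's ordered Čech
complexes are built on (`Literature/Algebra/Homology/OrderedCech`,
`Motives/CartierDivisorCech`). This file sets up that chartwise language:

* `FracFamily.stalkSpan y S = 𝒪_{Z,y} · S ⊆ K` — the `𝒪_{Z,y}`-submodule generated by `S ⊆ K`
  (as an `A`-submodule of `K` spanned by the products `f x`, `f` regular at `y`, `x ∈ S`;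
  `RatFn.IsRegularAt`), and `FracFamily.chartSpan V S = Γ(V, 𝒪_Z) · S` for a non-empty open `V`;
* `FracFamily.mem_stalkSpan_iff_exists` — **localization at a point of an affine chart**: for
  `V` affine, `y ∈ V` and `N ⊆ K` stable under `Γ(V, 𝒪_Z)`,
  `z ∈ 𝒪_{Z,y} · N ↔ b z ∈ N` for some `b ∈ Γ(V, 𝒪_Z)` not vanishing at `y`
  (`𝒪_{Z,y} = Γ(V)_{𝔭_y}`, Görtz–Wedhorn I, (2.10.2); `Motives/RatFnAffine`);
* `FracFamily.mem_of_forall_mem_stalkSpan` — **`N = ⋂_{y ∈ V} 𝒪_{Z,y} · N` for every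
  `Γ(V, 𝒪_Z)`-stable `N ⊆ K`** over an affine `V` (the ideal of denominators of an element of
  the intersection is contained in no maximal ideal; Görtz–Wedhorn I, Prop. 3.29 (3):
  `Γ(U, 𝒪_X) = ⋂_{x ∈ U} 𝒪_{X,x}` is the case `N = Γ(V, 𝒪_Z)`);
* `FracFamily.CoverData Z ι` — the intersections `U_t`, `t ⊆ ι` finite, of a finite cover of `Z`
  by non-empty affine opens with affine intersections (e.g. `CartierDivisor.CechCover.opens`);
* `FracFamily.IsCoherent 𝔘 L` — a monotone family `L : Finset ι → Submodule A K` is **coherent**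
  when each `L t` (`t ≠ ∅`) is a finitely generated `Γ(U_t, 𝒪_Z)`-submodule of `K` and the
  stalks do not depend on the chart: `𝒪_{Z,y} · L t = 𝒪_{Z,y} · L s` for `s ⊆ t`, `y ∈ U_t`;
* `FracFamily.IsCoherent.eq_chartSpan` — **quasi-coherence**: `L t = Γ(U_t, 𝒪_Z) · L s` for
  `∅ ≠ s ⊆ t` (Görtz–Wedhorn I, Thm. 7.16 / (7.9): `𝓕(D(f)) = 𝓕(U)_f`, here for arbitrary
  affine `U_t ⊆ U_s` through the stalks).

This is the vocabulary of the rank-one dévissage of the finiteness theorem for the Čech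
cohomology of `𝒪(D)` on proper schemes (Görtz–Wedhorn II, Thm. 23.17; EGA III 3.2.1) carried out
in the sequel files; everything here is elementary and proved. Mathlib searched (pin v4.32):
`IsAffineOpen.primeIdealOf`, `IsAffineOpen.fromSpec`, `IsAffineOpen.isLocalization_stalk`
(through the tree's `RatFn.isRegularAt_iff_exists`, `RatFn.isUnitAt_algebraMap_iff`),
`Ideal.exists_le_maximal`, `Submodule.span_induction` (used); Mathlib has no (quasi-)coherent
subsheaves of the sheaf of rational functions.

## References

* U. Görtz, T. Wedhorn, *Algebraic Geometry I: Schemes*, 2nd ed. (2020): (2.10.2); Prop. 3.29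
  (PDF p. 102); (7.9), PDF p. 224, and Thm. 7.16, PDF p. 227; (11.9) Def. 11.24 (pp. 373–376). [GortzWedhorn2020]
* U. Görtz, T. Wedhorn, *Algebraic Geometry II* (2023): Thm. 23.17 and its proof (PDF pp. 424–425).
  [GortzWedhorn2023]
* The Stacks Project, Tags 01AI, 01BU (modules over the constant sheaf; coherent modules).
-/

universe u v

open CategoryTheory AlgebraicGeometry TopologicalSpace Opposite

noncomputable section

namespace Literature.AlgebraicGeometry.Motives

namespace FracFamily

open RatFn

variable {Z : Scheme.{u}} [IsIntegral Z]
variable {A : Type v} [CommRing A] [Algebra A Z.functionField]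

/-! ### The `𝒪_{Z,y}`-span of a set of rational functions -/

/-- **`𝒪_{Z,y} · S`**: the `A`-submodule of `K(Z)` spanned by the products `f x` with `f` regular
at `y` and `x ∈ S` (an `𝒪_{Z,y}`-submodule of `K(Z)`, `isRegularAt_mul_mem_stalkSpan`). [folklore] -/
def stalkSpan (y : Z) (S : Set Z.functionField) : Submodule A Z.functionField :=
  Submodule.span A {z | ∃ f x, IsRegularAt y f ∧ x ∈ S ∧ f * x = z}

/-- `S ⊆ 𝒪_{Z,y} · S`. [folklore] -/
theorem subset_stalkSpan (y : Z) (S : Set Z.functionField) : S ⊆ (stalkSpan (A := A) y S : Set _) :=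
  fun x hx => Submodule.subset_span ⟨1, x, isRegularAt_one, hx, one_mul x⟩

/-- `𝒪_{Z,y} · S` is monotone in `S`. [folklore] -/
theorem stalkSpan_mono (y : Z) {S T : Set Z.functionField} (h : S ⊆ T) :
    stalkSpan (A := A) y S ≤ stalkSpan y T :=
  Submodule.span_mono fun _ ⟨f, x, hf, hx, e⟩ => ⟨f, x, hf, h hx, e⟩

/-- **`𝒪_{Z,y} · S` is stable under multiplication by functions regular at `y`.** [folklore] -/
theorem isRegularAt_mul_mem_stalkSpan {y : Z} {S : Set Z.functionField} {f z : Z.functionField}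
    (hf : IsRegularAt y f) (hz : z ∈ stalkSpan (A := A) y S) : f * z ∈ stalkSpan (A := A) y S := by
  induction hz using Submodule.span_induction with
  | mem w hw =>
    obtain ⟨g, x, hg, hx, rfl⟩ := hw
    exact Submodule.subset_span ⟨f * g, x, hf.mul hg, hx, mul_assoc f g x⟩
  | zero => rw [mul_zero]; exact Submodule.zero_mem _
  | add w w' _ _ hw hw' => rw [mul_add]; exact Submodule.add_mem _ hw hw'
  | smul a w _ hw => rw [mul_smul_comm]; exact Submodule.smul_mem _ a hw

/-- `𝒪_{Z,y} · (𝒪_{Z,y} · S) = 𝒪_{Z,y} · S`. [folklore] -/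
theorem stalkSpan_stalkSpan (y : Z) (S : Set Z.functionField) :
    stalkSpan (A := A) y (stalkSpan (A := A) y S) = stalkSpan y S := by
  refine le_antisymm (Submodule.span_le.2 ?_) (stalkSpan_mono y (subset_stalkSpan y S))
  rintro _ ⟨f, x, hf, hx, rfl⟩
  exact isRegularAt_mul_mem_stalkSpan hf hx

/-- `𝒪_{Z,y} · S ≤ N` as soon as `S ⊆ N` and `N` is stable under functions regular at `y`.
[folklore] -/
theorem stalkSpan_le {y : Z} {S : Set Z.functionField} {N : Submodule A Z.functionField}
    (hS : S ⊆ N) (hN : ∀ f z, IsRegularAt y f → z ∈ N → f * z ∈ N) : stalkSpan y S ≤ N :=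
  Submodule.span_le.2 fun _ ⟨f, x, hf, hx, e⟩ => e ▸ hN f x hf (hS hx)

/-- **Stalks shrink under specialisation**: if `ζ ⤳ y` then `𝒪_{Z,y} ⊆ 𝒪_{Z,ζ}` inside `K(Z)`,
so `𝒪_{Z,y} · S ≤ 𝒪_{Z,ζ} · S`. [folklore] -/
theorem isRegularAt_of_specializes {ζ y : Z} (h : ζ ⤳ y) {f : Z.functionField}
    (hf : IsRegularAt y f) : IsRegularAt ζ f := by
  obtain ⟨t, rfl⟩ := hf
  refine ⟨Z.presheaf.stalkSpecializes h t, ?_⟩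
  change (Z.presheaf.stalkSpecializes h ≫ Z.presheaf.stalkSpecializes
    ((genericPoint_spec Z).specializes (Set.mem_univ ζ))).hom t = _
  rw [TopCat.Presheaf.stalkSpecializes_comp]
  rfl

/-- `𝒪_{Z,y} · S ≤ 𝒪_{Z,ζ} · S` for `ζ ⤳ y`. [folklore] -/
theorem stalkSpan_le_of_specializes {ζ y : Z} (h : ζ ⤳ y) (S : Set Z.functionField) :
    stalkSpan (A := A) y S ≤ stalkSpan ζ S :=
  Submodule.span_mono fun _ ⟨f, x, hf, hx, e⟩ => ⟨f, x, isRegularAt_of_specializes h hf, hx, e⟩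

/-! ### The `Γ(V, 𝒪_Z)`-span of a set of rational functions -/

section Chart

variable (V : Z.Opens) [Nonempty V]

/-- **`Γ(V, 𝒪_Z) · S`**: the `A`-submodule of `K(Z)` spanned by the products `b x`, `b ∈ Γ(V, 𝒪_Z)`
(read in `K(Z)`), `x ∈ S`. [folklore] -/
def chartSpan (S : Set Z.functionField) : Submodule A Z.functionField :=
  Submodule.span A {z | ∃ (b : Γ(Z, V)) (x : Z.functionField), x ∈ S ∧
    algebraMap Γ(Z, V) Z.functionField b * x = z}

/-- `S ⊆ Γ(V) · S`. [folklore] -/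
theorem subset_chartSpan (S : Set Z.functionField) : S ⊆ (chartSpan (A := A) V S : Set _) :=
  fun x hx => Submodule.subset_span ⟨1, x, hx, by rw [map_one, one_mul]⟩

/-- `Γ(V) · S` is monotone in `S`. [folklore] -/
theorem chartSpan_mono {S T : Set Z.functionField} (h : S ⊆ T) :
    chartSpan (A := A) V S ≤ chartSpan V T :=
  Submodule.span_mono fun _ ⟨b, x, hx, e⟩ => ⟨b, x, h hx, e⟩

/-- **`Γ(V) · S` is stable under `Γ(V, 𝒪_Z)`.** [folklore] -/
theorem algebraMap_mul_mem_chartSpan {S : Set Z.functionField} (b : Γ(Z, V)) {z : Z.functionField}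
    (hz : z ∈ chartSpan (A := A) V S) :
    algebraMap Γ(Z, V) Z.functionField b * z ∈ chartSpan (A := A) V S := by
  induction hz using Submodule.span_induction with
  | mem w hw =>
    obtain ⟨c, x, hx, rfl⟩ := hw
    exact Submodule.subset_span ⟨b * c, x, hx, by rw [map_mul, mul_assoc]⟩
  | zero => rw [mul_zero]; exact Submodule.zero_mem _
  | add w w' _ _ hw hw' => rw [mul_add]; exact Submodule.add_mem _ hw hw'
  | smul a w _ hw => rw [mul_smul_comm]; exact Submodule.smul_mem _ a hw

/-- `Γ(V) · S ≤ N` as soon as `S ⊆ N` and `N` is `Γ(V)`-stable. [folklore] -/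
theorem chartSpan_le {S : Set Z.functionField} {N : Submodule A Z.functionField} (hS : S ⊆ N)
    (hN : ∀ (b : Γ(Z, V)) z, z ∈ N → algebraMap Γ(Z, V) Z.functionField b * z ∈ N) :
    chartSpan V S ≤ N :=
  Submodule.span_le.2 fun _ ⟨b, x, hx, e⟩ => e ▸ hN b x (hS hx)

/-- A `Γ(V)`-stable submodule is its own `Γ(V)`-span. [folklore] -/
theorem chartSpan_eq_self {N : Submodule A Z.functionField}
    (hN : ∀ (b : Γ(Z, V)) z, z ∈ N → algebraMap Γ(Z, V) Z.functionField b * z ∈ N) :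
    chartSpan V (N : Set Z.functionField) = N :=
  le_antisymm (chartSpan_le V subset_rfl hN) (subset_chartSpan V _)

/-- Sections over `V` are regular at the points of `V`, so `Γ(V) · S ⊆ 𝒪_{Z,y} · S` for `y ∈ V`.
[folklore] -/
theorem chartSpan_le_stalkSpan {y : Z} (hy : y ∈ V) (S : Set Z.functionField) :
    chartSpan (A := A) V S ≤ stalkSpan y S :=
  Submodule.span_mono fun _ ⟨b, x, hx, e⟩ =>
    ⟨_, x, isRegularAt_algebraMap_sections (⟨y, hy⟩ : V) b, hx, e⟩

/-- `𝒪_{Z,y} · (Γ(V) · S) = 𝒪_{Z,y} · S` for `y ∈ V`. [folklore] -/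
theorem stalkSpan_chartSpan {y : Z} (hy : y ∈ V) (S : Set Z.functionField) :
    stalkSpan (A := A) y (chartSpan (A := A) V S) = stalkSpan y S := by
  refine le_antisymm ?_ (stalkSpan_mono y (subset_chartSpan V S))
  calc stalkSpan (A := A) y (chartSpan (A := A) V S)
      ≤ stalkSpan y (stalkSpan (A := A) y S) := stalkSpan_mono y (chartSpan_le_stalkSpan V hy S)
    _ = stalkSpan y S := stalkSpan_stalkSpan y S

end Chart

/-! ### Localization at a point of an affine chart, and `N = ⋂_y 𝒪_{Z,y} · N` -/

section Affine

variable {V : Z.Opens} (hV : IsAffineOpen V) [Nonempty V]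
include hV

/-- **`𝒪_{Z,y} · N` is the localization of `N` at `y`**: for `V` affine, `y ∈ V` and a
`Γ(V, 𝒪_Z)`-stable `N ⊆ K(Z)`, `z ∈ 𝒪_{Z,y} · N` iff `b z ∈ N` for some section `b` over `V` not
vanishing at `y` (`𝒪_{Z,y} = Γ(V, 𝒪_Z)_{𝔭_y}` inside `K(Z)`; Görtz–Wedhorn I, (2.10.2)).
[folklore] -/
theorem mem_stalkSpan_iff_exists (y : V) {N : Submodule A Z.functionField}
    (hN : ∀ (b : Γ(Z, V)) z, z ∈ N → algebraMap Γ(Z, V) Z.functionField b * z ∈ N)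
    (z : Z.functionField) :
    z ∈ stalkSpan (A := A) (y : Z) (N : Set Z.functionField) ↔
      ∃ b : Γ(Z, V), b ∉ (hV.primeIdealOf y).asIdeal ∧
        algebraMap Γ(Z, V) Z.functionField b * z ∈ N := by
  constructor
  · intro hz
    induction hz using Submodule.span_induction with
    | mem w hw =>
      obtain ⟨f, x, hf, hx, rfl⟩ := hw
      obtain ⟨a, b, hb, e⟩ := (isRegularAt_iff_exists hV y f).1 hf
      refine ⟨b, hb, ?_⟩
      rw [← mul_assoc, mul_comm (algebraMap _ _ b) f, e]
      exact hN a x hx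
    | zero => exact ⟨1, (Ideal.ne_top_iff_one _).1 (hV.primeIdealOf y).2.ne_top,
        by rw [mul_zero]; exact N.zero_mem⟩
    | add w w' _ _ hw hw' =>
      obtain ⟨b, hb, hbw⟩ := hw
      obtain ⟨b', hb', hbw'⟩ := hw'
      refine ⟨b * b', fun h => ((hV.primeIdealOf y).2.mem_or_mem h).elim hb hb', ?_⟩
      have e1 : algebraMap Γ(Z, V) Z.functionField b * algebraMap Γ(Z, V) Z.functionField b' * w =
          algebraMap Γ(Z, V) Z.functionField b' * (algebraMap Γ(Z, V) Z.functionField b * w) := by ring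
      have e2 : algebraMap Γ(Z, V) Z.functionField b * algebraMap Γ(Z, V) Z.functionField b' * w' =
          algebraMap Γ(Z, V) Z.functionField b * (algebraMap Γ(Z, V) Z.functionField b' * w') := by ring
      rw [mul_add, map_mul, e1, e2]
      exact N.add_mem (hN b' _ hbw) (hN b _ hbw')
    | smul a w _ hw =>
      obtain ⟨b, hb, hbw⟩ := hw
      exact ⟨b, hb, by rw [mul_smul_comm]; exact N.smul_mem a hbw⟩
  · rintro ⟨b, hb, hbz⟩
    have hbu : IsUnitAt (y : Z) (algebraMap Γ(Z, V) Z.functionField b) :=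
      (isUnitAt_algebraMap_iff hV y b).2 hb
    have hb0 : algebraMap Γ(Z, V) Z.functionField b ≠ 0 := hbu.ne_zero
    refine Submodule.subset_span ⟨(algebraMap Γ(Z, V) Z.functionField b)⁻¹, _,
      hbu.inv.isRegularAt, hbz, ?_⟩
    rw [← mul_assoc, inv_mul_cancel₀ hb0, one_mul]

/-- **`N = ⋂_{y ∈ V} 𝒪_{Z,y} · N`** for an affine open `V` and a `Γ(V, 𝒪_Z)`-stable `N ⊆ K(Z)`:
a rational function lying in every localization of `N` at the points of `V` lies in `N` (its
ideal of denominators is contained in no maximal ideal of `Γ(V, 𝒪_Z)`; Görtz–Wedhorn I,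
Prop. 3.29 (3) for `N = Γ(V, 𝒪_Z)`). [folklore] -/
theorem mem_of_forall_mem_stalkSpan {N : Submodule A Z.functionField}
    (hN : ∀ (b : Γ(Z, V)) z, z ∈ N → algebraMap Γ(Z, V) Z.functionField b * z ∈ N)
    {z : Z.functionField} (hz : ∀ y : V, z ∈ stalkSpan (A := A) (y : Z) (N : Set Z.functionField)) :
    z ∈ N := by
  -- the ideal of denominators
  let I : Ideal Γ(Z, V) :=
    { carrier := {b | algebraMap Γ(Z, V) Z.functionField b * z ∈ N}
      zero_mem' := by
        change algebraMap Γ(Z, V) Z.functionField 0 * z ∈ N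
        rw [map_zero, zero_mul]; exact N.zero_mem
      add_mem' := fun {b b'} hb hb' => by
        change algebraMap Γ(Z, V) Z.functionField (b + b') * z ∈ N
        rw [map_add, add_mul]; exact N.add_mem hb hb'
      smul_mem' := fun c b hb => by
        change algebraMap Γ(Z, V) Z.functionField (c * b) * z ∈ N
        rw [map_mul, mul_assoc]; exact hN c _ hb }
  by_cases hI : I = ⊤
  · have h1 : (1 : Γ(Z, V)) ∈ I := hI ▸ Submodule.mem_top
    have : algebraMap Γ(Z, V) Z.functionField 1 * z ∈ N := h1
    rwa [map_one, one_mul] at this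
  · obtain ⟨m, hm, hIm⟩ := Ideal.exists_le_maximal I hI
    let q : PrimeSpectrum Γ(Z, V) := ⟨m, hm.isPrime⟩
    let y : V := ⟨hV.fromSpec q, FieldNorm.fromSpec_mem hV q⟩
    obtain ⟨b, hb, hbz⟩ := (mem_stalkSpan_iff_exists hV y hN z).1 (hz y)
    have hq : hV.primeIdealOf y = q := FieldNorm.primeIdealOf_fromSpec hV q
    rw [hq] at hb
    exact absurd (hIm hbz) hb

/-- **`Γ(V) · S = ⋂_{y ∈ V} 𝒪_{Z,y} · S`** over an affine open. [folklore] -/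
theorem mem_chartSpan_of_forall_mem_stalkSpan {S : Set Z.functionField} {z : Z.functionField}
    (hz : ∀ y : V, z ∈ stalkSpan (A := A) (y : Z) S) : z ∈ chartSpan (A := A) V S := by
  refine mem_of_forall_mem_stalkSpan hV (fun b w hw => algebraMap_mul_mem_chartSpan V b hw) ?_
  intro y
  rw [stalkSpan_chartSpan V y.2]
  exact hz y

/-- **Localizations of `Γ(V)`-stable submodules commute with finite intersections.** [folklore] -/
theorem stalkSpan_inf (y : V) {N N' : Submodule A Z.functionField}
    (hN : ∀ (b : Γ(Z, V)) z, z ∈ N → algebraMap Γ(Z, V) Z.functionField b * z ∈ N)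
    (hN' : ∀ (b : Γ(Z, V)) z, z ∈ N' → algebraMap Γ(Z, V) Z.functionField b * z ∈ N') :
    stalkSpan (A := A) (y : Z) ((N ⊓ N' : Submodule A Z.functionField) : Set Z.functionField) =
      stalkSpan (A := A) (y : Z) (N : Set Z.functionField) ⊓ stalkSpan (y : Z) (N' : Set _) := by
  refine le_antisymm (le_inf (stalkSpan_mono _ fun _ h => h.1) (stalkSpan_mono _ fun _ h => h.2)) ?_
  rintro z ⟨hz, hz'⟩
  obtain ⟨b, hb, hbz⟩ := (mem_stalkSpan_iff_exists hV y hN z).1 hz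
  obtain ⟨b', hb', hbz'⟩ := (mem_stalkSpan_iff_exists hV y hN' z).1 hz'
  refine (mem_stalkSpan_iff_exists hV y (N := N ⊓ N') (fun c w hw => ⟨hN c w hw.1, hN' c w hw.2⟩)
    z).2 ⟨b * b', fun h => ((hV.primeIdealOf y).2.mem_or_mem h).elim hb hb', ?_, ?_⟩
  · rw [map_mul, mul_comm (algebraMap _ _ b), mul_assoc]
    exact hN b' _ hbz
  · rw [map_mul, mul_assoc]
    exact hN' b _ hbz'

end Affine

/-! ### Covers with affine intersections and coherent families -/

/-- **The intersections of a finite affine cover of an integral scheme**: opens `U_t`, `t ⊆ ι`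
finite, antitone in `t`, with `U_t = ⋂_{a ∈ t} U_{a}` for `t ≠ ∅`, all `U_t` (`t ≠ ∅`) affine and
containing the generic point, the `U_{a}` covering `Z` (e.g. `CartierDivisor.CechCover.opens` for a
Čech cover over an affine base of a separated `Z`; `U_∅` is unconstrained). [folklore] -/
structure CoverData (Z : Scheme.{u}) [IsIntegral Z] (ι : Type) where
  /-- The intersections `U_t`. -/
  U : Finset ι → Z.Opens
  /-- `U_t ⊆ U_s` for `s ⊆ t`. -/
  anti : ∀ ⦃s t : Finset ι⦄, s ⊆ t → U t ≤ U s
  /-- `⋂_{a ∈ t} U_{a} ⊆ U_t` for `t ≠ ∅`. -/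
  mem_of_forall : ∀ ⦃t : Finset ι⦄, t.Nonempty → ∀ ⦃y : Z⦄, (∀ a ∈ t, y ∈ U {a}) → y ∈ U t
  /-- The `U_t`, `t ≠ ∅`, are affine. -/
  affine : ∀ ⦃t : Finset ι⦄, t.Nonempty → IsAffineOpen (U t)
  /-- All `U_t` contain the generic point. -/
  genericPoint_mem : ∀ t, genericPoint Z ∈ U t
  /-- The `U_{a}` cover `Z`. -/
  exists_mem : ∀ y : Z, ∃ a, y ∈ U {a}

namespace CoverData

variable {ι : Type} (𝔘 : CoverData Z ι)

/-- The `U_t` are non-empty. [folklore] -/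
instance nonempty_U (t : Finset ι) : Nonempty (𝔘.U t) := ⟨⟨genericPoint Z, 𝔘.genericPoint_mem t⟩⟩

/-- Membership in `U_t`, `t ≠ ∅`. [folklore] -/
theorem mem_iff {t : Finset ι} (ht : t.Nonempty) {y : Z} : y ∈ 𝔘.U t ↔ ∀ a ∈ t, y ∈ 𝔘.U {a} :=
  ⟨fun hy _ ha => 𝔘.anti (Finset.singleton_subset_iff.2 ha) hy, fun h => 𝔘.mem_of_forall ht h⟩

/-- `U_t ⊆ U_{a}` for `a ∈ t`. [folklore] -/
theorem le_single {t : Finset ι} {a : ι} (ha : a ∈ t) : 𝔘.U t ≤ 𝔘.U {a} :=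
  𝔘.anti (Finset.singleton_subset_iff.2 ha)

end CoverData

/-- **A coherent family of rational functions** on the cover `𝔘`: a monotone family
`L : Finset ι → Submodule A K(Z)` (restriction = inclusion) such that every `L t`, `t ≠ ∅`, is a
finitely generated `Γ(U_t, 𝒪_Z)`-submodule of `K(Z)`, and the stalks `𝒪_{Z,y} · L t`, `y ∈ U_t`,
do not depend on the chart `t ∋ y` — the sections `t ↦ Γ(U_t, 𝓛)` of a coherent
`𝒪_Z`-submodule `𝓛 ⊆ 𝒦_Z` (Görtz–Wedhorn I, (7.9) and (11.9); e.g. `𝓛 = 𝒪_Z(D)`,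
`CartierDivisor.CechCover.sectionsOn`). [folklore] -/
structure IsCoherent {ι : Type} (𝔘 : CoverData Z ι) (L : Finset ι → Submodule A Z.functionField) :
    Prop where
  /-- Restriction is inclusion. -/
  mono : Monotone L
  /-- `L t` is a `Γ(U_t, 𝒪_Z)`-module. -/
  smul_mem : ∀ ⦃t : Finset ι⦄, t.Nonempty → ∀ (b : Γ(Z, 𝔘.U t)) ⦃x : Z.functionField⦄, x ∈ L t →
    algebraMap Γ(Z, 𝔘.U t) Z.functionField b * x ∈ L t
  /-- `L t` is finitely generated over `Γ(U_t, 𝒪_Z)`. -/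
  fg : ∀ ⦃t : Finset ι⦄, t.Nonempty → ∃ S : Finset Z.functionField,
    (S : Set Z.functionField) ⊆ L t ∧ L t ≤ chartSpan (𝔘.U t) (S : Set Z.functionField)
  /-- Stalks do not depend on the chart. -/
  stalk_le : ∀ ⦃s t : Finset ι⦄, s.Nonempty → s ⊆ t → ∀ ⦃y : Z⦄, y ∈ 𝔘.U t →
    stalkSpan (A := A) y (L t : Set Z.functionField) ≤ stalkSpan y (L s : Set Z.functionField)

namespace IsCoherent

variable {ι : Type} {𝔘 : CoverData Z ι} {L : Finset ι → Submodule A Z.functionField}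
  (hL : IsCoherent 𝔘 L)
include hL

/-- The stalks of a coherent family are the same on all charts through the point. [folklore] -/
theorem stalkSpan_eq {s t : Finset ι} (hs : s.Nonempty) (hst : s ⊆ t) {y : Z} (hy : y ∈ 𝔘.U t) :
    stalkSpan (A := A) y (L t : Set Z.functionField) = stalkSpan y (L s : Set Z.functionField) :=
  le_antisymm (hL.stalk_le hs hst hy) (stalkSpan_mono y (hL.mono hst))

/-- `L t` is its own `Γ(U_t)`-span. [folklore] -/
theorem chartSpan_self {t : Finset ι} (ht : t.Nonempty) :
    chartSpan (A := A) (𝔘.U t) (L t : Set Z.functionField) = L t :=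
  chartSpan_eq_self (𝔘.U t) fun b _ hz => hL.smul_mem ht b hz

/-- `L t` is the `Γ(U_t)`-span of the finite set provided by `fg`. [folklore] -/
theorem exists_finset_eq_chartSpan {t : Finset ι} (ht : t.Nonempty) :
    ∃ S : Finset Z.functionField, (S : Set Z.functionField) ⊆ L t ∧
      L t = chartSpan (𝔘.U t) (S : Set Z.functionField) := by
  obtain ⟨S, hS, hle⟩ := hL.fg ht
  exact ⟨S, hS, le_antisymm hle (chartSpan_le (𝔘.U t) hS fun b _ hz => hL.smul_mem ht b hz)⟩

/-- **Quasi-coherence of a coherent family**: `L t = Γ(U_t, 𝒪_Z) · L s` for `∅ ≠ s ⊆ t` — the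
sections over the smaller affine `U_t ⊆ U_s` are generated by those over `U_s`
(Görtz–Wedhorn I, (7.9); proof through the stalks and `mem_of_forall_mem_stalkSpan`).
[cite: GortzWedhorn2020, (7.9) (PDF p. 224) with Thm. 7.16 (PDF p. 227) and Prop. 3.29 (PDF p. 102)] -/
theorem eq_chartSpan {s t : Finset ι} (hs : s.Nonempty) (hst : s ⊆ t) :
    L t = chartSpan (𝔘.U t) (L s : Set Z.functionField) := by
  have ht : t.Nonempty := hs.mono hst
  refine le_antisymm ?_ (chartSpan_le (𝔘.U t) (fun x hx => hL.mono hst hx)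
    fun b _ hz => hL.smul_mem ht b hz)
  intro z hz
  refine mem_chartSpan_of_forall_mem_stalkSpan (𝔘.affine ht) fun y => ?_
  rw [← hL.stalkSpan_eq hs hst y.2]
  exact subset_stalkSpan _ _ hz

/-! ### Stalks of a coherent family -/

/-- The stalk of a coherent family at `y ∈ U_t` may be computed on any vertex chart `U_{a}`,
`a ∈ t`. [folklore] -/
theorem stalkSpan_eq_single {t : Finset ι} {a : ι} (ha : a ∈ t) {y : Z} (hy : y ∈ 𝔘.U t) :
    stalkSpan (A := A) y (L t : Set Z.functionField) = stalkSpan y (L {a} : Set Z.functionField) :=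
  hL.stalkSpan_eq (Finset.singleton_nonempty a) (Finset.singleton_subset_iff.2 ha) hy

/-- **The stalk of a coherent family at a point does not depend on the vertex chart through it.**
[folklore] -/
theorem stalkSpan_single_eq_single {a b : ι} {y : Z} (ha : y ∈ 𝔘.U {a}) (hb : y ∈ 𝔘.U {b}) :
    stalkSpan (A := A) y (L {a} : Set Z.functionField) = stalkSpan y (L {b} : Set Z.functionField) := by
  classical
  have hy : y ∈ 𝔘.U ({a, b} : Finset ι) :=
    𝔘.mem_of_forall (Finset.insert_nonempty a {b}) fun c hc => by
      rcases Finset.mem_insert.1 hc with rfl | hc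
      · exact ha
      · rw [Finset.mem_singleton.1 hc]; exact hb
  rw [← hL.stalkSpan_eq_single (Finset.mem_insert_self a {b}) hy,
    ← hL.stalkSpan_eq_single (Finset.mem_insert_of_mem (Finset.mem_singleton_self b)) hy]

/-! ### The members as modules over the rings of sections -/

/-- `L t` as a `Γ(U_t, 𝒪_Z)`-submodule of `K(Z)`. [folklore] -/
def chartModule {t : Finset ι} (ht : t.Nonempty) : Submodule Γ(Z, 𝔘.U t) Z.functionField where
  carrier := L t
  zero_mem' := (L t).zero_mem
  add_mem' hx hy := (L t).add_mem hx hy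
  smul_mem' b _ hx := by
    rw [Algebra.smul_def]
    exact hL.smul_mem ht b hx

/-- Membership in `chartModule`. [folklore] -/
@[simp] theorem mem_chartModule {t : Finset ι} (ht : t.Nonempty) {x : Z.functionField} :
    x ∈ hL.chartModule ht ↔ x ∈ L t := Iff.rfl

omit hL in
/-- Scalars of `A` regular on all of `Z` act on `K(Z)` through sections over any non-empty open:
`a • x = c x` for the section `c` of `a` over `V`. [folklore] -/
theorem exists_smul_eq_algebraMap_mul
    (hA : ∀ (a : A) (y : Z), IsRegularAt y (algebraMap A Z.functionField a))
    (V : Z.Opens) (hV : genericPoint Z ∈ V) (a : A) :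
    ∃ c : Γ(Z, V), ∀ x : Z.functionField,
      haveI : Nonempty V := ⟨⟨_, hV⟩⟩
      a • x = algebraMap Γ(Z, V) Z.functionField c * x := by
  refine ⟨sectionOf hV (algebraMap A Z.functionField a) fun y _ => hA a y, fun x => ?_⟩
  rw [Algebra.smul_def]
  congr 1
  exact (ofSection_sectionOf hV (algebraMap A Z.functionField a) fun y _ => hA a y).symm

omit hL in
/-- Over a non-empty open `V`, the `Γ(V, 𝒪_Z)`-span of `S` and `Γ(V) · S` (an `A`-span) have the
same elements, provided the scalars of `A` are regular on `Z`. [folklore] -/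
theorem mem_span_iff_mem_chartSpan
    (hA : ∀ (a : A) (y : Z), IsRegularAt y (algebraMap A Z.functionField a))
    (V : Z.Opens) [Nonempty V] (S : Set Z.functionField) (x : Z.functionField) :
    x ∈ Submodule.span Γ(Z, V) S ↔ x ∈ chartSpan (A := A) V S := by
  have hV : genericPoint Z ∈ V := by
    obtain ⟨⟨z, hz⟩⟩ := ‹Nonempty V›
    exact genericPoint_mem_of_mem hz
  constructor
  · intro hx
    induction hx using Submodule.span_induction with
    | mem w hw => exact subset_chartSpan V S hw
    | zero => exact Submodule.zero_mem _
    | add w w' _ _ hw hw' => exact Submodule.add_mem _ hw hw'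
    | smul b w _ hw => rw [Algebra.smul_def]; exact algebraMap_mul_mem_chartSpan V b hw
  · intro hx
    induction hx using Submodule.span_induction with
    | mem w hw =>
      obtain ⟨b, z, hz, rfl⟩ := hw
      rw [← Algebra.smul_def]
      exact Submodule.smul_mem _ b (Submodule.subset_span hz)
    | zero => exact Submodule.zero_mem _
    | add w w' _ _ hw hw' => exact Submodule.add_mem _ hw hw'
    | smul a w _ hw =>
      obtain ⟨c, hc⟩ := exists_smul_eq_algebraMap_mul hA V hV a
      rw [hc w, ← Algebra.smul_def]
      exact Submodule.smul_mem _ c hw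

/-- **`L t` is a finitely generated `Γ(U_t, 𝒪_Z)`-module** (scalars of `A` regular on `Z`).
[folklore] -/
theorem fg_chartModule (hA : ∀ (a : A) (y : Z), IsRegularAt y (algebraMap A Z.functionField a))
    {t : Finset ι} (ht : t.Nonempty) : (hL.chartModule ht).FG := by
  obtain ⟨S, hS, hLe⟩ := hL.exists_finset_eq_chartSpan ht
  refine ⟨S, le_antisymm (Submodule.span_le.2 fun x hx => hS hx) fun x hx => ?_⟩
  rw [mem_span_iff_mem_chartSpan hA]
  rw [mem_chartModule] at hx
  rw [← hLe]
  exact hx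

omit [CommRing A] [Algebra A Z.functionField] hL in
/-- The ring of sections over an affine chart of a locally Noetherian scheme is Noetherian
(Mathlib `IsLocallyNoetherian.component_noetherian`). [folklore] -/
theorem isNoetherianRing_sections [IsLocallyNoetherian Z] {t : Finset ι} (ht : t.Nonempty) :
    IsNoetherianRing Γ(Z, 𝔘.U t) :=
  IsLocallyNoetherian.component_noetherian ⟨𝔘.U t, 𝔘.affine ht⟩

/-- **A `Γ(U_t, 𝒪_Z)`-submodule of `L t` is the `Γ(U_t)`-span of a finite set** (`Z` locally
Noetherian, scalars of `A` regular on `Z`). [folklore] -/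
theorem exists_finset_of_le [IsLocallyNoetherian Z]
    (hA : ∀ (a : A) (y : Z), IsRegularAt y (algebraMap A Z.functionField a))
    {t : Finset ι} (ht : t.Nonempty) (N : Submodule Γ(Z, 𝔘.U t) Z.functionField)
    (hN : N ≤ hL.chartModule ht) :
    ∃ S : Finset Z.functionField, (S : Set Z.functionField) ⊆ N ∧
      ∀ x, x ∈ N ↔ x ∈ chartSpan (A := A) (𝔘.U t) (S : Set Z.functionField) := by
  haveI := isNoetherianRing_sections (𝔘 := 𝔘) ht
  haveI : IsNoetherian Γ(Z, 𝔘.U t) (hL.chartModule ht) :=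
    isNoetherian_of_fg_of_noetherian _ (hL.fg_chartModule hA ht)
  have hfg : (N.comap (hL.chartModule ht).subtype).FG := IsNoetherian.noetherian _
  have hmap : (N.comap (hL.chartModule ht).subtype).map (hL.chartModule ht).subtype = N := by
    rw [Submodule.map_comap_eq, Submodule.range_subtype]
    exact inf_eq_right.2 hN
  obtain ⟨S, hS⟩ := hfg.map (hL.chartModule ht).subtype
  rw [hmap] at hS
  refine ⟨S, fun x hx => hS ▸ Submodule.subset_span hx, fun x => ?_⟩
  rw [← mem_span_iff_mem_chartSpan hA, hS]

end IsCoherent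

/-! ### Intersections of coherent families -/

/-- **The intersection of two coherent families is coherent** (`Z` locally Noetherian, scalars of
`A` regular on `Z`): finite generation because `Γ(U_t, 𝒪_Z)` is Noetherian, and localization
commutes with finite intersections (`stalkSpan_inf`). [folklore] -/
theorem IsCoherent.inf [IsLocallyNoetherian Z] {ι : Type} {𝔘 : CoverData Z ι}
    {L G : Finset ι → Submodule A Z.functionField}
    (hA : ∀ (a : A) (y : Z), IsRegularAt y (algebraMap A Z.functionField a))
    (hL : IsCoherent 𝔘 L) (hG : IsCoherent 𝔘 G) : IsCoherent 𝔘 fun t => L t ⊓ G t where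
  mono _ _ hst := inf_le_inf (hL.mono hst) (hG.mono hst)
  smul_mem _ ht b _ hx := ⟨hL.smul_mem ht b hx.1, hG.smul_mem ht b hx.2⟩
  fg t ht := by
    let N : Submodule Γ(Z, 𝔘.U t) Z.functionField :=
      { carrier := (L t ⊓ G t : Submodule A Z.functionField)
        zero_mem' := Submodule.zero_mem _
        add_mem' := fun hx hy => Submodule.add_mem _ hx hy
        smul_mem' := fun b x hx => by
          rw [Algebra.smul_def]
          exact ⟨hL.smul_mem ht b hx.1, hG.smul_mem ht b hx.2⟩ }
    obtain ⟨S, hS, hiff⟩ := hL.exists_finset_of_le hA ht N fun x hx => hx.1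
    exact ⟨S, hS, fun x hx => (hiff x).1 hx⟩
  stalk_le s t hs hst y hy := by
    have ht : t.Nonempty := hs.mono hst
    have hys : y ∈ 𝔘.U s := 𝔘.anti hst hy
    have hLt := fun (b : Γ(Z, 𝔘.U t)) z (hz : z ∈ L t) => hL.smul_mem ht b hz
    have hGt := fun (b : Γ(Z, 𝔘.U t)) z (hz : z ∈ G t) => hG.smul_mem ht b hz
    have hLs := fun (b : Γ(Z, 𝔘.U s)) z (hz : z ∈ L s) => hL.smul_mem hs b hz
    have hGs := fun (b : Γ(Z, 𝔘.U s)) z (hz : z ∈ G s) => hG.smul_mem hs b hz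
    have e1 := stalkSpan_inf (A := A) (𝔘.affine ht) ⟨y, hy⟩ hLt hGt
    have e2 := stalkSpan_inf (A := A) (𝔘.affine hs) ⟨y, hys⟩ hLs hGs
    change stalkSpan y ((L t ⊓ G t : Submodule A Z.functionField) : Set Z.functionField) ≤
      stalkSpan y ((L s ⊓ G s : Submodule A Z.functionField) : Set Z.functionField)
    rw [e1, e2]
    exact inf_le_inf (hL.stalk_le hs hst hy) (hG.stalk_le hs hst hy)

end FracFamily

end Literature.AlgebraicGeometry.Motives

end
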